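import Summits.Ventures.PercRepro.RankLevelSetExplicitLin2KeyL

/-!
# PercRepro — THE LEVEL-15 THEOREM-M ROW OF C-025 OVER THE 5/8 RANGE: THE KEY AT `p = 21 005` (p9, S4; the key is p4's)

`proofs/SUBCLAIM-S4-p9.md` §S4.2⁗⁗. p4's THEOREM-M key `KeyL 15 p d` (RankLevelSetExplicitLin2KeyL) checked by the kernel at
`p = 21 005` on the coranks `16 ≤ d ≤ 20495` of THE 5/8 RANGE (`D' = 15 + 5·2^{12} = 20495`; the large-corank theorem
`c025_core_explicit_large_of58` takes the coranks beyond): `21 005` = the least `p` with the optimal Chernoff pair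
`16·n^n ≤ 2^n·(n − K)^{n−K}·K^K` at `n = p + D'`, `K = 15 + D'` (twin lean-drafts/p9/g7/twin/range58.py), at or above the key's
own floor and the bases `N₁ = 20 687`, `P₂ = 20 527` (RankLevelSetExplicitLin2Bases58); p4's sharp row sits at `33 419`
(RankLevelSetExplicitLin2IndepFloorS). The level step and the unconditional chain are RankLevelSetExplicitLin2IndepFloor58.
Axioms: standard (kernel `decide`).
-/
-- part A: chunks 1 … 8 of 10

namespace PercRepro

namespace ThmN

namespace Explicit

/-- The THEOREM-M key row at `(q, p) = (15, 21 005)`, chunk 1 of 10: coranks `16 … 2063`, by the kernel. -/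
theorem key_fifteen_indep58_row_1 : ∀ t < 2048, KeyL 15 21005 (16 + t) := by decide +kernel

/-- The THEOREM-M key row at `(q, p) = (15, 21 005)`, chunk 2 of 10: coranks `2064 … 4111`, by the kernel. -/
theorem key_fifteen_indep58_row_2 : ∀ t < 2048, KeyL 15 21005 (16 + (2048 + t)) := by decide +kernel

/-- The THEOREM-M key row at `(q, p) = (15, 21 005)`, chunk 3 of 10: coranks `4112 … 6159`, by the kernel. -/
theorem key_fifteen_indep58_row_3 : ∀ t < 2048, KeyL 15 21005 (16 + (4096 + t)) := by decide +kernel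

/-- The THEOREM-M key row at `(q, p) = (15, 21 005)`, chunk 4 of 10: coranks `6160 … 8207`, by the kernel. -/
theorem key_fifteen_indep58_row_4 : ∀ t < 2048, KeyL 15 21005 (16 + (6144 + t)) := by decide +kernel

/-- The THEOREM-M key row at `(q, p) = (15, 21 005)`, chunk 5 of 10: coranks `8208 … 10255`, by the kernel. -/
theorem key_fifteen_indep58_row_5 : ∀ t < 2048, KeyL 15 21005 (16 + (8192 + t)) := by decide +kernel

/-- The THEOREM-M key row at `(q, p) = (15, 21 005)`, chunk 6 of 10: coranks `10256 … 12303`, by the kernel. -/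
theorem key_fifteen_indep58_row_6 : ∀ t < 2048, KeyL 15 21005 (16 + (10240 + t)) := by decide +kernel

/-- The THEOREM-M key row at `(q, p) = (15, 21 005)`, chunk 7 of 10: coranks `12304 … 14351`, by the kernel. -/
theorem key_fifteen_indep58_row_7 : ∀ t < 2048, KeyL 15 21005 (16 + (12288 + t)) := by decide +kernel

/-- The THEOREM-M key row at `(q, p) = (15, 21 005)`, chunk 8 of 10: coranks `14352 … 16399`, by the kernel. -/
theorem key_fifteen_indep58_row_8 : ∀ t < 2048, KeyL 15 21005 (16 + (14336 + t)) := by decide +kernel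

end Explicit

end ThmN

end PercRepro
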